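import Mathlib
import HarnessLib
import Summits.HubbardSuperconductivity.HubbardSuperconductivity.Theorems.KLProgrammeKLRegimeVolumeLimitDefs
import Summits.HubbardSuperconductivity.HubbardSuperconductivity.Theorems.KLProgrammeKLRegimeTwoPointAssemblySlotThreshold
import Summits.HubbardSuperconductivity.HubbardSuperconductivity.Theorems.KLProgrammeKLRegimeSplitGenericV4
import Summits.HubbardSuperconductivity.HubbardSuperconductivity.Theorems.KLProgrammeKLRegimeSplitBundleV12

/-!
# Route `KLProgramme` — Δ-VL1 (plan g11, HOME/STATUS 2026-08-26T23:34:46Z): the ∃-THRESHOLD volume-limit slot `FinalTwoLegVolLimitEx`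
# bound into the gen-4 children 4–5 (`VolumeLimitP2 klPredsV12 FinalTwoLegVolLimitEx klWindowC`, `TwoPointAssemblyP3 klPredsV12 FinalTwoLegVolLimitEx klWindowC`)

WHY (numbers, not taste).  As typed through gen 3, child 5 owes `FinalTwoLegVolLimit β U μ K Mstar` at the TOWER's Matsubara threshold `Mstar`,
which it receives only through `TowerP`, whose slots carry no clause on `klSelfEnergy … (nScales β + 1)` at general `(ω, k)`; the direct routes
to its uniform-bound clause (the `M = ∞` exact/`O(U)` carrier of `…ThermalGreenHubbardTorusExact`, the Cauchy two-volume criterion) deliver it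
only beyond their OWN threshold `M'(β, L, U)`.  The one-token repair: the slot `fun β U μ K _ => ∃ Mstar', FinalTwoLegVolLimit β U μ K Mstar'`,
named here so the resplit kit swaps one token.  Downstream cost ZERO: child 4 closes for EVERY bundle and window by
`twoPointAssemblyP3_existsThreshold` (`…TwoPointAssemblySlotThreshold`, p470883), and the K3 glue is `KLRegimeInductionP4 Pr _` (generic in the
slot; the named V12 instance is `…SplitGlueV12P4Ex`).  Route-file-FREE (this module is imported BY the route file).

* `FinalTwoLegVolLimitEx` — the slot (a `VolLimitSlot`; ignores its threshold argument);
* `finalTwoLegVolLimitEx_iff`, `finalTwoLegVolLimitEx_of` (the old text implies the new at any thresholds);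
* `volumeLimitP2_ex_of` — `VolumeLimitP2 Pr FinalTwoLegVolLimit W → VolumeLimitP2 Pr FinalTwoLegVolLimitEx W` (nothing proved toward the gen-3 child is lost);
* `twoPointAssemblyP3_ex` — `TwoPointAssemblyP3 Pr FinalTwoLegVolLimitEx W` for EVERY `Pr`, `W` (child 4 closes at birth);
* `twoPointAssemblyP3_klPredsV12_ex` — the gen-4 instance.
-/

noncomputable section

namespace Summit.HubbardSuperconductivity.HubbardSuperconductivity.Theorems.KLRegimeSplit

set_option linter.dupNamespace false -- summit = problem name (single-conjunct summit), D-0017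

open Literature.MathematicalPhysics.QuantumLattice Literature.Probability.LatticeModels
open Summit.HubbardSuperconductivity.HubbardSuperconductivity.Theorems.KLProgrammeLegKernels
open Summit.HubbardSuperconductivity.HubbardSuperconductivity.Theorems.TwoPointAssembly

/-- **The ∃-threshold volume-limit slot** (Δ-VL1): `FinalTwoLegVolLimitEx β U μ K _ := ∃ Mstar', FinalTwoLegVolLimit β U μ K Mstar'` — clause (i)
of the VL text carries the PROVER's own Matsubara threshold; the slot's last argument (the tower's threshold) is ignored. -/
def FinalTwoLegVolLimitEx : VolLimitSlot := fun β U μ K _ => ∃ Mstar' : ℕ → ℕ, FinalTwoLegVolLimit β U μ K Mstar'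

/-- Unfolding. -/
theorem finalTwoLegVolLimitEx_iff (β U μ : ℝ) (K : TrigPolyC4v) (Ms : ℕ → ℕ) :
    FinalTwoLegVolLimitEx β U μ K Ms ↔ ∃ Mstar' : ℕ → ℕ, FinalTwoLegVolLimit β U μ K Mstar' := Iff.rfl

/-- The gen-3 text implies the ∃-slot at ANY pair of thresholds. -/
theorem finalTwoLegVolLimitEx_of {β U μ : ℝ} {K : TrigPolyC4v} {Ms : ℕ → ℕ} (Ms' : ℕ → ℕ) (h : FinalTwoLegVolLimit β U μ K Ms) :
    FinalTwoLegVolLimitEx β U μ K Ms' := ⟨Ms, h⟩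

/-- **Nothing is lost**: a proof of child 5 with the gen-3 slot gives child 5 with the ∃-slot (every bundle, every window). -/
theorem volumeLimitP2_ex_of {Pr : Preds} {W : Set ℝ} (h : VolumeLimitP2 Pr FinalTwoLegVolLimit W) : VolumeLimitP2 Pr FinalTwoLegVolLimitEx W := by
  intro G P Q R hG hP hQ hR
  obtain ⟨c₅, hc₅, hc⟩ := h G P Q R hG hP hQ hR
  refine ⟨c₅, hc₅, fun c hc0 hcle => ?_⟩
  obtain ⟨U₀, hU₀, hmain⟩ := hc c hc0 hcle
  refine ⟨U₀, hU₀, fun μ hμ U hU hUle β hβ hβle K hK Lstar Mstar hT => ?_⟩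
  show ∃ Mstar' : ℕ → ℕ, FinalTwoLegVolLimit β U μ K Mstar'
  exact ⟨Mstar, hmain μ hμ U hU hUle β hβ hβle K hK Lstar Mstar hT⟩

/-- **Child 4 with the ∃-slot closes for EVERY bundle and window** (`twoPointAssemblyP3_existsThreshold`, p470883). -/
theorem twoPointAssemblyP3_ex (Pr : Preds) (W : Set ℝ) : TwoPointAssemblyP3 Pr FinalTwoLegVolLimitEx W :=
  twoPointAssemblyP3_existsThreshold Pr W

/-- **The gen-4 instance**: `TwoPointAssemblyP3 klPredsV12 FinalTwoLegVolLimitEx klWindowC`. -/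
theorem twoPointAssemblyP3_klPredsV12_ex : TwoPointAssemblyP3 klPredsV12 FinalTwoLegVolLimitEx klWindowC :=
  twoPointAssemblyP3_ex _ _

end Summit.HubbardSuperconductivity.HubbardSuperconductivity.Theorems.KLRegimeSplit

end
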